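import Literature.Computability.MetaComplexity.CuttingPlanesTree
import HarnessLib

/-!
# Extending cutting planes derivations: tree-like steps over already-derived lines

`CuttingPlanesTree.lean` linearises TREE-LIKE derivations; dag-like constructions (such as the
simulation of resolution, `CuttingPlanesSimulatesResolution.lean`, where every derived clause
is reused) need to extend an EXISTING annotated derivation `pre` by a small tree whose leaves
may be lines of `pre`.  This file provides exactly that: the inductive predicate
`CPTreeH φ W pre L s` — "`L` is derivable by a tree with `s` NEW lines of norm `≤ W`, from the
axioms of `φ` and from the lines of `pre` (free of charge)" — and `CPTreeH.linearize`: if `pre`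
is a derivation of norm `≤ W`, there is an extension `pre ++ ext`, `|ext| = s`, which is again a
derivation of norm `≤ W` and contains the line `L` (at some index).  Earlier indices keep their
lines under extension (`List.getElem_append_left`), which is what a dag construction needs.
(Cook–Coullard–Turán 1987, §2: derivations may cite any earlier line.)

## References

* W. Cook, C. R. Coullard, Gy. Turán, Discrete Appl. Math. 18 (1987), §2
  [CookCoullardTuran1987].
-/

namespace Literature.Computability.MetaComplexity

open Literature.Computability.Complexity CPLine

variable {ν : Type*} [DecidableEq ν]

/-- **Tree-like derivability over a prefix**: `CPTreeH φ W pre L s` — `L` is derivable by a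
tree-like cutting planes derivation with `s` new lines of `ℓ¹`-norm `≤ W`, whose leaves are
axioms of `φ` or (at no cost) lines of the already-derived prefix `pre`.
[cite: CookCoullardTuran1987, §2] -/
inductive CPTreeH (φ : CNF ν) (W : ℕ) (pre : List (CPStep ν)) : CPLine ν → ℕ → Prop
  /-- an already-derived line of the prefix -/
  | hyp (i : ℕ) (hi : i < pre.length) : CPTreeH φ W pre (pre[i]'hi).line 0
  /-- a clause axiom -/
  | initial {C : Clause ν} (hC : C ∈ φ) (hW : (ofClause C).norm ≤ W) : CPTreeH φ W pre (ofClause C) 1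
  /-- a lower bound `x ≥ 0` -/
  | lower (v : ν) (hW : (lower v).norm ≤ W) : CPTreeH φ W pre (lower v) 1
  /-- an upper bound `-x ≥ -1` -/
  | upper (v : ν) (hW : (upper v).norm ≤ W) : CPTreeH φ W pre (upper v) 1
  /-- addition -/
  | add {L M : CPLine ν} {s t : ℕ} (hL : CPTreeH φ W pre L s) (hM : CPTreeH φ W pre M t)
      (hW : (L + M).norm ≤ W) : CPTreeH φ W pre (L + M) (s + t + 1)
  /-- multiplication by `c` -/
  | mul {L : CPLine ν} {s : ℕ} (c : ℕ) (hL : CPTreeH φ W pre L s) (hW : (smul c L).norm ≤ W) :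
      CPTreeH φ W pre (smul c L) (s + 1)
  /-- division by `c > 0` dividing all coefficients -/
  | div {L : CPLine ν} {s : ℕ} (c : ℕ) (hc : 0 < c) (hd : ∀ v, (c : ℤ) ∣ L.coeff v)
      (hL : CPTreeH φ W pre L s) (hW : (divBy c L).norm ≤ W) : CPTreeH φ W pre (divBy c L) (s + 1)

namespace CPTreeH

variable {φ : CNF ν} {W : ℕ} {pre : List (CPStep ν)}

/-- Transport along an equality of lines. [folklore] -/
theorem of_eq {L L' : CPLine ν} {s : ℕ} (h : CPTreeH φ W pre L s) (e : L = L') : CPTreeH φ W pre L' s := e ▸ h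

/-- Transport along equalities of line and size. [folklore] -/
theorem of_eq_of_eq {L L' : CPLine ν} {s s' : ℕ} (h : CPTreeH φ W pre L s) (e : L = L') (e' : s = s') :
    CPTreeH φ W pre L' s' := e' ▸ e ▸ h

/-- Every line of such a tree has norm `≤ W` provided the prefix has; in particular its
conclusion. [folklore] -/
theorem norm_le {L : CPLine ν} {s : ℕ} (h : CPTreeH φ W pre L s) (hpre : ∀ st ∈ pre, st.line.norm ≤ W) :
    L.norm ≤ W := by
  induction h with
  | hyp i hi => exact hpre _ (List.getElem_mem hi)
  | _ => assumption

/-- **Linearisation over a prefix**: if `pre ++ mid` is a derivation of norm `≤ W` (the tree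
only cites lines of `pre`, but more lines `mid` may already have been appended), a tree with
`s` new lines extends it to a derivation `pre ++ mid ++ ext`, `|ext| = s`, of norm `≤ W`
containing the conclusion `L` at some index. [cite: CookCoullardTuran1987, §2] -/
theorem linearize {L : CPLine ν} {s : ℕ} (h : CPTreeH φ W pre L s) :
    ∀ mid : List (CPStep ν), IsCPDerivation φ (pre ++ mid) → (∀ st ∈ pre ++ mid, st.line.norm ≤ W) →
      ∃ ext : List (CPStep ν), ext.length = s ∧ IsCPDerivation φ (pre ++ mid ++ ext) ∧
        (∀ st ∈ pre ++ mid ++ ext, st.line.norm ≤ W) ∧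
        ∃ idx : ℕ, ∃ hidx : idx < (pre ++ mid ++ ext).length, ((pre ++ mid ++ ext)[idx]'hidx).line = L := by
  induction h with
  | hyp i hi =>
    intro mid hd hn
    refine ⟨[], rfl, by simpa using hd, by simpa using hn, i, by simp; omega, ?_⟩
    simp only [List.append_nil]
    rw [List.getElem_append_left hi]
  | initial hC hW =>
    intro mid hd hn
    refine ⟨[⟨ofClause _, .initial⟩], rfl, hd.append_step ⟨_, hC, rfl⟩, ?_, (pre ++ mid).length, by simp, ?_⟩
    · intro st hst
      rcases List.mem_append.1 hst with hst | hst
      · exact hn st hst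
      · rw [List.mem_singleton] at hst; rw [hst]; exact hW
    · simp
  | lower v hW =>
    intro mid hd hn
    refine ⟨[⟨CPLine.lower v, .lower v⟩], rfl, hd.append_step (by unfold IsValidCPStep; rfl), ?_,
      (pre ++ mid).length, by simp, ?_⟩
    · intro st hst
      rcases List.mem_append.1 hst with hst | hst
      · exact hn st hst
      · rw [List.mem_singleton] at hst; rw [hst]; exact hW
    · simp
  | upper v hW =>
    intro mid hd hn
    refine ⟨[⟨CPLine.upper v, .upper v⟩], rfl, hd.append_step (by unfold IsValidCPStep; rfl), ?_,
      (pre ++ mid).length, by simp, ?_⟩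
    · intro st hst
      rcases List.mem_append.1 hst with hst | hst
      · exact hn st hst
      · rw [List.mem_singleton] at hst; rw [hst]; exact hW
    · simp
  | @add L M s t hL hM hW ihL ihM =>
    intro mid hd hn
    obtain ⟨e1, he1, hd1, hn1, i, hi, hLi⟩ := ihL mid hd hn
    have hd1' : IsCPDerivation φ (pre ++ (mid ++ e1)) := by simpa [List.append_assoc] using hd1
    have hn1' : ∀ st ∈ pre ++ (mid ++ e1), st.line.norm ≤ W := by simpa [List.append_assoc] using hn1
    obtain ⟨e2, he2, hd2, hn2, j, hj, hMj⟩ := ihM (mid ++ e1) hd1' hn1'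
    have hassoc : pre ++ (mid ++ e1) ++ e2 = (pre ++ mid ++ e1) ++ e2 := by simp
    have hi' : i < (pre ++ (mid ++ e1) ++ e2).length := by
      simp only [List.length_append] at hi ⊢; omega
    have hLi' : ((pre ++ (mid ++ e1) ++ e2)[i]'hi').line = L := by
      rw [List.getElem_of_eq hassoc, List.getElem_append_left hi]; exact hLi
    let st : CPStep ν := ⟨L + M, .add i j⟩
    have hstl : st.line = L + M := rfl
    have hval : IsValidCPStep φ (pre ++ (mid ++ e1) ++ e2) st := ⟨hi', hj, by rw [hstl, hLi', hMj]⟩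
    have hd3 := hd2.append_step hval
    refine ⟨e1 ++ e2 ++ [st], by simp [he1, he2]; ring, by simpa [List.append_assoc] using hd3, ?_,
      (pre ++ (mid ++ e1) ++ e2).length, by simp, ?_⟩
    · intro st' hst'
      have hn2' : ∀ st' ∈ pre ++ (mid ++ e1) ++ e2, st'.line.norm ≤ W := hn2
      simp only [List.append_assoc, List.mem_append, List.mem_singleton] at hst' hn2'
      rcases hst' with hst' | hst' | hst' | hst' | rfl
      · exact hn2' _ (Or.inl hst')
      · exact hn2' _ (Or.inr (Or.inl hst'))
      · exact hn2' _ (Or.inr (Or.inr (Or.inl hst')))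
      · exact hn2' _ (Or.inr (Or.inr (Or.inr hst')))
      · exact hW
    · have e : pre ++ mid ++ (e1 ++ e2 ++ [st]) = (pre ++ (mid ++ e1) ++ e2) ++ [st] := by simp
      simp only [e]
      rw [List.getElem_append_right le_rfl]
      simp [hstl]
  | @mul L s c hL hW ih =>
    intro mid hd hn
    obtain ⟨e1, he1, hd1, hn1, i, hi, hLi⟩ := ih mid hd hn
    let st : CPStep ν := ⟨smul c L, .mul c i⟩
    have hstl : st.line = smul c L := rfl
    have hval : IsValidCPStep φ (pre ++ mid ++ e1) st := ⟨hi, by rw [hstl, hLi]⟩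
    have hd2 := hd1.append_step hval
    refine ⟨e1 ++ [st], by simp [he1], by simpa [List.append_assoc] using hd2, ?_,
      (pre ++ mid ++ e1).length, by simp, ?_⟩
    · intro st' hst'
      have hn1' : ∀ st' ∈ pre ++ mid ++ e1, st'.line.norm ≤ W := hn1
      rw [show pre ++ mid ++ (e1 ++ [st]) = (pre ++ mid ++ e1) ++ [st] by simp] at hst'
      rcases List.mem_append.1 hst' with hst' | hst'
      · exact hn1' _ hst'
      · rw [List.mem_singleton] at hst'; rw [hst']; exact hW
    · have e : pre ++ mid ++ (e1 ++ [st]) = (pre ++ mid ++ e1) ++ [st] := by simp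
      simp only [e]
      rw [List.getElem_append_right le_rfl]
      simp [hstl]
  | @div L s c hc hdv hL hW ih =>
    intro mid hd hn
    obtain ⟨e1, he1, hd1, hn1, i, hi, hLi⟩ := ih mid hd hn
    let st : CPStep ν := ⟨divBy c L, .div c i⟩
    have hstl : st.line = divBy c L := rfl
    have hval : IsValidCPStep φ (pre ++ mid ++ e1) st := ⟨hi, hc, by rw [hLi]; exact hdv, by rw [hstl, hLi]⟩
    have hd2 := hd1.append_step hval
    refine ⟨e1 ++ [st], by simp [he1], by simpa [List.append_assoc] using hd2, ?_,
      (pre ++ mid ++ e1).length, by simp, ?_⟩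
    · intro st' hst'
      have hn1' : ∀ st' ∈ pre ++ mid ++ e1, st'.line.norm ≤ W := hn1
      rw [show pre ++ mid ++ (e1 ++ [st]) = (pre ++ mid ++ e1) ++ [st] by simp] at hst'
      rcases List.mem_append.1 hst' with hst' | hst'
      · exact hn1' _ hst'
      · rw [List.mem_singleton] at hst'; rw [hst']; exact hW
    · have e : pre ++ mid ++ (e1 ++ [st]) = (pre ++ mid ++ e1) ++ [st] := by simp
      simp only [e]
      rw [List.getElem_append_right le_rfl]
      simp [hstl]

/-- **Extension step** (the form used by dag constructions): a derivation `pre` of norm `≤ W`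
and a tree over `pre` with `s` new lines concluding `L` give a derivation `pre ++ ext`,
`|ext| = s`, of norm `≤ W`, in which `L` occurs. [cite: CookCoullardTuran1987, §2] -/
theorem extend {L : CPLine ν} {s : ℕ} (h : CPTreeH φ W pre L s) (hd : IsCPDerivation φ pre)
    (hn : ∀ st ∈ pre, st.line.norm ≤ W) :
    ∃ ext : List (CPStep ν), ext.length = s ∧ IsCPDerivation φ (pre ++ ext) ∧
      (∀ st ∈ pre ++ ext, st.line.norm ≤ W) ∧
      ∃ idx : ℕ, ∃ hidx : idx < (pre ++ ext).length, ((pre ++ ext)[idx]'hidx).line = L := by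
  have := h.linearize [] (by simpa using hd) (by simpa using hn)
  simpa using this

end CPTreeH

end Literature.Computability.MetaComplexity
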